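import Summits.AtomisticToContinuum.BoseEinsteinCondensation.Theses.BECInsertionCorrector
import Summits.AtomisticToContinuum.BoseEinsteinCondensation.Theorems.StaticResponseBound.Negative.Basic
import Literature.MathematicalPhysics.QuantumManyBody.BoseGasStructureFactor
import Literature.MathematicalPhysics.QuantumManyBody.PeriodicBoseGasMomentumSector
import HarnessLib.Audit

/-!
# Line `stable-fraction-square-completion` — crux `StaticResponseBound` (stmt-AtomisticToContinuum-12057)

Lead skeleton v2 (lead prover-line-stmt-AtomisticToContinuum-12057-1, 2026-08-16), built on the planner's
checked skeleton `Lines/stable-fraction-square-completion.lean` (triage r1: pass ×3).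

**Crux** (routes BECInsertionCorrector rank 2 / BECBathMassLiouville rank 3, verbatim identical —
`Negative.staticResponseBound_routes_agree`): for every repulsive finite-range `v` there are `ρ₀, C > 0` with
`E₀ − C t² N / max(ρa, |p|²) ≤ ⟨Ψ, HΨ⟩ + t ⟨∑ⱼ cos(p·xⱼ)⟩_Ψ` for all `ρ < ρ₀`, ALL `N`, all `k ≠ 0`
(`p = 2πk/L`, `L = (N/ρ)^{1/3}`), all `t` and every finite-energy periodic `Ψ`; equivalently
(`Negative.forall_ineq_iff_discriminant`) the all-states susceptibility bound
`⟨∑cos⟩_Ψ² ≤ 4CN(E_Ψ − E₀)/max(ρa,|p|²)`.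

**Lever.** Borrow the fraction `θ < 1` of the Bogoliubov vertex `g_p = 8πa + |p|²/(2ρ)` as a single-mode
mean-field ATTRACTION `−(θ g_p/L³)(|ρ̂_p|² − N)` (a bounded two-body multiplication operator; hard cores
allowed, no Fourier transform of `v`).  Stability + hyperuniformity of that SOFTENED functional at the one
mode `p` (stub A) is, after one application of the variational principle (stub C1), the ENERGY-CONTROLLED
STRUCTURE FACTOR `(θg_p/L³)‖ρ̂_pΦ‖² ≤ ⟨Φ,(H−E₀)Φ⟩ + θρg_p C_H |p|/√(ρa) ‖Φ‖²` for EVERY finite-energy state `Φ`;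
the centre-of-mass (Bloch) sector decomposition of a periodic `C¹` state with Parseval for the norm, the energy
form (hard cores included) and the `ρ̂_p` pairing (stub C2α), Cauchy–Schwarz over the sector pairs `(q, q+p)` with
the sector floor (stub B) on the stiffer member (stub C2β), and the discriminant in `t` (stub C3) give the crux on
the whole phonon + crossover branch `|p| ≤ M₀√(ρa)` with `C = 2(1+K₀)/θ`, `K₀ = 2θ(8π+M₀²/2)C_H/θ_L`.  The kinetic
branch `|p| > M₀√(ρa)` is NOT claimed by this line (stub D is the registered interface to the sibling line
`uv-thomson-force-wave`, whose kernel-checked `kineticBranch_of` delivers it modulo its own registered stubs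
`stub_uvForceWaveBound` (S5, crux-sized, promote-stub filed by the first lead), `stub_modulatedMinimiserExists` (F1)
and `stub_maxFormBound`).

**Registered stubs of skeleton v2** (7 = stubs_max; every stub is stated WRITTEN OUT in tree vocabulary —
Literature defs + the landed `Theorems/StaticResponseBound/Negative/Basic.lean` (`psq`, `cosMean`, `Ineq`) — so
that a stub file under `Theorems/` can state exactly the registered text without importing this work file; the
readable `def`s below are definitionally equal abbreviations, see the `_iff` lemmas proved by `Iff.rfl`):
* A  `stub_softenedModeHyperuniformity` (lead; XL, crux-sized going in) — softened-mode hyperuniformity.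
* B  `stub_sectorFloor` (XL; = LandauSectorBound stmt-9091 for ALL `N` + far floor) — sector floor.
* C1 `stub_ecsf_of_hyperuniformity` (S) — variational principle: A ⇒ energy-controlled structure factor.
* C2α `stub_sectorDecomposition` (L) — Bloch/centre-of-mass sector components of a periodic `C¹` state:
  regularity, periodicity, symmetry, total momentum, Parseval for norm / energy form / `ρ̂_p`-pairing.
* C2β `stub_sectorCauchySchwarz` (M) — C2α ⇒ the bilinear sector reduction
  `⟨∑cos⟩_Ψ² ≤ 4((1 + D/Δ)/λ)(E_Ψ − E₀)` from ECSF `(λ, D)` and a floor `Δ` on the stiffer member of each pair.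
* C3 `stub_windowAssembly` (M) — ECSF → SectorFloor → SectorCauchySchwarz → `StaticResponseBoundPhonon`
  (window bookkeeping `L³ = N/ρ`, `ρg_p ≥ max/2`, `|q| ∨ |q+p| ≥ |p|/2`, discriminant).
* D  `stub_kineticBranch` (interface, = sibling's `KineticBranch`) — the kinetic branch.
Glue (kernel-checked, axiom-clean): `stub_windowReduction := C3 ∘ (C1, id, C2β C2α)`,
`StaticResponseBound_of : A → B → C → D → StaticResponseBound`, `StaticResponseBound_proof`.

**Disproof.lean used** (Cruxes/StaticResponseBound/Disproof.lean, gen 2, re-read 2026-08-16T04:10Z) + landed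
`Theorems/StaticResponseBound/Negative/*.lean`: §A (`Body`/`Ineq`/discriminant — imported, used by name in C3 and
`_of`), §B `not_staticResponseBoundAnyK` (`k ≠ 0` kept in A, C1, C2β, C3, D; used in C3: `p ≠ 0` separates the
sectors and makes `Δ > 0`), §E `not_staticResponseBoundWithoutFiniteEnergy` (finite-energy guard kept in A
(`IsSoftenedNearMin`), C1, C2β, C3, D; every `toReal` runs on finite-energy states), §C tightness `C ≥ 1/2`
(`C = 2(1+K₀)/θ`; A forces `θ ≤ 1`-ish so `C ≥ 2`), §G (`ineq_N_zero` in `_of`), Learning 4 (θ existential, meant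
small), Learning 5 (window algebra: the sectors `q = 0`, `q = −p` are covered because the stiffer member of the
pair is `±p` itself), §H (no charge/corrector functions: every integrand is continuous).  `## Targets`: none
registered at gen 2.  No landed `Negative/*` lemma negates a sector floor, a structure-factor bound or a
regime-restricted body (Negative/UvThomson* concern the sibling's stubs).
-/

namespace Summit.AtomisticToContinuum.BoseEinsteinCondensation.Cruxes.StaticResponseBound.StableFractionSquareCompletion

open MeasureTheory
open scoped ENNReal ComplexConjugate
open Literature.MathematicalPhysics.QuantumManyBody.BoseGas
open Summit.AtomisticToContinuum.BoseEinsteinCondensation.Theses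
open Summit.AtomisticToContinuum.BoseEinsteinCondensation.Theorems.StaticResponseBound.Negative
  (psq cosMean Ineq Body staticResponseBound_iff ineq_N_zero)

noncomputable section

/-! ### Vocabulary of the line (all over existing declarations) -/

/-- The Bogoliubov vertex of the mode `p = 2πk/L`, `L = (N/ρ)^{1/3}`: `g_p = 8πa + |p|²/(2ρ)`
(so that `ρ g_p = 8πρa + |p|²/2 = e_p²/(2|p|²)` and `N/(4θρg_p) = θ⁻¹ · N|p|²/(2e_p²)` is `θ⁻¹` times
Bogoliubov's static response). -/
def vertex (v : ℝ → ℝ≥0∞) (ρ : ℝ) (N : ℕ) (k : Fin 3 → ℤ) : ℝ :=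
  8 * Real.pi * (scatteringLength v).toReal + psq (sideLength ρ N) k / (2 * ρ)

/-- `⟨|ρ̂_p|²⟩_Φ = ∫_{cell^N} |∑ⱼ e^{ip·xⱼ}|² |Φ|²` — the raw second moment of the density wave
(`densityWave`, BoseGasStructureFactor) in the state `Φ`; `= N S_Φ(p) + |⟨ρ̂_p⟩_Φ|²`. -/
def densityWaveSqMean {N : ℕ} (L : ℝ) (k : Fin 3 → ℤ) (Φ : PeriodicTrialState N L) : ℝ :=
  ∫ X in cellN N L, ‖densityWave N L k X‖ ^ 2 * ‖Φ.ψ X‖ ^ 2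

/-- The SOFTENED energy `F_g(Φ) = ⟨Φ, (H − (g/L³)(|ρ̂_p|² − N)) Φ⟩` of a finite-energy periodic state. -/
def softenedEnergy (v : ℝ → ℝ≥0∞) {N : ℕ} {L : ℝ} (g : ℝ) (k : Fin 3 → ℤ)
    (Φ : PeriodicTrialState N L) : ℝ :=
  (periodicEnergy v Φ).toReal - g / L ^ 3 * (densityWaveSqMean L k Φ - N)

/-- `Φ` is a finite-energy `δ`-near-minimiser of the softened functional `F_g` among the finite-energy
periodic states. -/
def IsSoftenedNearMin (v : ℝ → ℝ≥0∞) {N : ℕ} {L : ℝ} (g : ℝ) (k : Fin 3 → ℤ) (δ : ℝ)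
    (Φ : PeriodicTrialState N L) : Prop :=
  periodicEnergy v Φ ≠ ⊤ ∧
    ∀ Φ' : PeriodicTrialState N L, periodicEnergy v Φ' ≠ ⊤ →
      softenedEnergy v g k Φ ≤ softenedEnergy v g k Φ' + δ

/-- The crux's inner inequality on the PHONON + CROSSOVER branch `|p|² ≤ M₀² ρa`, `N ≥ 1`. -/
def PhononBody (v : ℝ → ℝ≥0∞) (M₀ ρ₀ C : ℝ) : Prop :=
  ∀ ρ : ℝ, 0 < ρ → ρ < ρ₀ → ∀ N : ℕ, 0 < N → ∀ k : Fin 3 → ℤ, k ≠ 0 →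
    psq (sideLength ρ N) k ≤ M₀ ^ 2 * (ρ * (scatteringLength v).toReal) →
    ∀ t : ℝ, ∀ Ψ : PeriodicTrialState N (sideLength ρ N), periodicEnergy v Ψ ≠ ⊤ →
      Ineq v C ρ N k t Ψ

/-- The crux's inner inequality on the KINETIC branch `|p|² > M₀² ρa`, `N ≥ 1`. -/
def KineticBody (v : ℝ → ℝ≥0∞) (M₀ ρ₀ C : ℝ) : Prop :=
  ∀ ρ : ℝ, 0 < ρ → ρ < ρ₀ → ∀ N : ℕ, 0 < N → ∀ k : Fin 3 → ℤ, k ≠ 0 →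
    M₀ ^ 2 * (ρ * (scatteringLength v).toReal) < psq (sideLength ρ N) k →
    ∀ t : ℝ, ∀ Ψ : PeriodicTrialState N (sideLength ρ N), periodicEnergy v Ψ ≠ ⊤ →
      Ineq v C ρ N k t Ψ

/-- The crux restricted to the phonon + crossover branch, for EVERY window parameter `M₀`. -/
def StaticResponseBoundPhonon : Prop :=
  ∀ v : ℝ → ℝ≥0∞, IsRepulsiveFiniteRange v → ∀ M₀ : ℝ, 0 < M₀ →
    ∃ ρ₀ : ℝ, 0 < ρ₀ ∧ ∃ C : ℝ, 0 < C ∧ PhononBody v M₀ ρ₀ C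

/-- The crux restricted to the kinetic branch for SOME window parameter `M₀`. -/
def StaticResponseBoundKinetic : Prop :=
  ∀ v : ℝ → ℝ≥0∞, IsRepulsiveFiniteRange v →
    ∃ M₀ : ℝ, 0 < M₀ ∧ ∃ ρ₀ : ℝ, 0 < ρ₀ ∧ ∃ C : ℝ, 0 < C ∧ KineticBody v M₀ ρ₀ C

/-! ### The stub statements as readable `Prop`s -/

/-- **A — softened-mode hyperuniformity.** See the planner's card; `θ` existential and meant small. -/
def SoftenedModeHyperuniformity : Prop :=
  ∀ v : ℝ → ℝ≥0∞, IsRepulsiveFiniteRange v → ∀ M₀ : ℝ, 0 < M₀ →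
    ∃ ρ₀ : ℝ, 0 < ρ₀ ∧ ∃ θ : ℝ, 0 < θ ∧ ∃ C_H : ℝ, 0 ≤ C_H ∧
      ∀ ρ : ℝ, 0 < ρ → ρ < ρ₀ → ∀ N : ℕ, 0 < N → ∀ k : Fin 3 → ℤ, k ≠ 0 →
        psq (sideLength ρ N) k ≤ M₀ ^ 2 * (ρ * (scatteringLength v).toReal) →
        ∃ δ : ℝ, 0 < δ ∧ ∀ Φ : PeriodicTrialState N (sideLength ρ N),
          IsSoftenedNearMin v (θ * vertex v ρ N k) k δ Φ →
            densityWaveSqMean (sideLength ρ N) k Φ ≤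
              C_H * N * Real.sqrt (psq (sideLength ρ N) k) /
                Real.sqrt (ρ * (scatteringLength v).toReal)

/-- **B — sector floor (Landau with saturation), all `N ≥ 1`.** -/
def SectorFloor : Prop :=
  ∀ v : ℝ → ℝ≥0∞, IsRepulsiveFiniteRange v → ∀ M₀ : ℝ, 0 < M₀ →
    ∃ θL : ℝ, 0 < θL ∧ ∃ ρ₀ : ℝ, 0 < ρ₀ ∧ ∀ ρ : ℝ, 0 < ρ → ρ < ρ₀ → ∀ N : ℕ, 0 < N →
      ∀ m : Fin 3 → ℤ, m ≠ 0 →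
        periodicGroundStateEnergy v N (sideLength ρ N)
            + ENNReal.ofReal (θL * Real.sqrt (ρ * (scatteringLength v).toReal)
                * min (Real.sqrt (psq (sideLength ρ N) m))
                      (M₀ * Real.sqrt (ρ * (scatteringLength v).toReal)))
          ≤ momentumSectorEnergy v N (sideLength ρ N)
              ((2 * Real.pi / sideLength ρ N) •
                (WithLp.toLp 2 fun t => (m t : ℝ) : EuclideanSpace ℝ (Fin 3)))

/-- **ECSF — energy-controlled structure factor on the window** (conclusion of C1, first hypothesis of C3):
`(θg_p/L³)⟨|ρ̂_p|²⟩_Φ ≤ (E_Φ − E₀) + (θg_p/L³)·C_H N|p|/√(ρa)` for EVERY finite-energy `Φ`. -/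
def EnergyControlledStructureFactor : Prop :=
  ∀ v : ℝ → ℝ≥0∞, IsRepulsiveFiniteRange v → ∀ M₀ : ℝ, 0 < M₀ →
    ∃ ρ₀ : ℝ, 0 < ρ₀ ∧ ∃ θ : ℝ, 0 < θ ∧ ∃ C_H : ℝ, 0 ≤ C_H ∧
      ∀ ρ : ℝ, 0 < ρ → ρ < ρ₀ → ∀ N : ℕ, 0 < N → ∀ k : Fin 3 → ℤ, k ≠ 0 →
        psq (sideLength ρ N) k ≤ M₀ ^ 2 * (ρ * (scatteringLength v).toReal) →
        ∀ Φ : PeriodicTrialState N (sideLength ρ N), periodicEnergy v Φ ≠ ⊤ →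
          θ * vertex v ρ N k / sideLength ρ N ^ 3 * densityWaveSqMean (sideLength ρ N) k Φ ≤
            (periodicEnergy v Φ).toReal - (periodicGroundStateEnergy v N (sideLength ρ N)).toReal +
              θ * vertex v ρ N k / sideLength ρ N ^ 3 *
                (C_H * N * Real.sqrt (psq (sideLength ρ N) k) /
                  Real.sqrt (ρ * (scatteringLength v).toReal))

/-- **Sector decomposition** of a periodic `C¹` state (conclusion of C2α): a family of centre-of-mass
Fourier (Bloch) components `Φc q`, `q ∈ ℤ³` — each `C¹`, `Lℤ³`-periodic in every particle, Bose-symmetric,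
of total momentum `2πq/L` — with Parseval for the norm (`∑_q ‖Φc q‖² = 1`), for the energy form including the
interaction (`∑_q ⟨Φc q, H Φc q⟩ = ⟨Ψ, HΨ⟩` in `[0,∞]`, hard cores included), and for the density-wave pairing
(`∑_q ⟨Φc (q+k), ρ̂_k Φc q⟩ = ⟨Ψ, ρ̂_k Ψ⟩`).  Intended witness:
`Φc q X = L⁻³ ∫_{[0,L)³} e^{−2πi q·s/L} Ψ(x₁+s, …, x_N+s) ds`. -/
def SectorDecomposition : Prop :=
  ∀ (v : ℝ → ℝ≥0∞) (N : ℕ) (L : ℝ), 0 < L → ∀ (k : Fin 3 → ℤ) (Ψ : PeriodicTrialState N L),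
    ∃ Φc : (Fin 3 → ℤ) → Config N → ℂ,
      (∀ q, ContDiff ℝ 1 (Φc q)) ∧
      (∀ q (X : Config N) (i : Fin N) (a : Fin 3),
        Φc q (X + Pi.single i (EuclideanSpace.single a L)) = Φc q X) ∧
      (∀ q (σ : Equiv.Perm (Fin N)) (X : Config N), Φc q (X ∘ σ) = Φc q X) ∧
      (∀ q, HasTotalMomentum
        ((2 * Real.pi / L) • (WithLp.toLp 2 fun t => (q t : ℝ) : EuclideanSpace ℝ (Fin 3))) (Φc q)) ∧
      (∑' q, ∫⁻ X in cellN N L, (‖Φc q X‖₊ : ℝ≥0∞) ^ 2) = 1 ∧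
      (∑' q, ∫⁻ X in cellN N L,
          (kineticDensity (Φc q) X + periodicInteraction v L X * (‖Φc q X‖₊ : ℝ≥0∞) ^ 2)) =
        periodicEnergy v Ψ ∧
      HasSum (fun q : Fin 3 → ℤ =>
          ∫ X in cellN N L, conj (Φc (q + k) X) * (densityWave N L k X * Φc q X))
        (∫ X in cellN N L, densityWave N L k X * (((‖Ψ.ψ X‖ ^ 2 : ℝ)) : ℂ))

/-- **Sector Cauchy–Schwarz** (conclusion of C2β, third hypothesis of C3): at fixed `(N, L, k)`, an
energy-controlled structure factor with constants `(λ, D)` for all finite-energy states and a floor `Δ > 0`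
above `E₀` on the stiffer member of every sector pair `(q, q+k)` give, for every finite-energy `Ψ`,
`⟨∑ⱼcos(p·xⱼ)⟩_Ψ² ≤ 4((1 + D/Δ)/λ)(E_Ψ − E₀)`. -/
def SectorCauchySchwarz : Prop :=
  ∀ (v : ℝ → ℝ≥0∞) (N : ℕ) (L : ℝ), 0 < L → ∀ (k : Fin 3 → ℤ), k ≠ 0 →
    ∀ (lam D Δ : ℝ), 0 < lam → 0 ≤ D → 0 < Δ →
    (∀ Φ : PeriodicTrialState N L, periodicEnergy v Φ ≠ ⊤ →
      lam * ∫ X in cellN N L, ‖densityWave N L k X‖ ^ 2 * ‖Φ.ψ X‖ ^ 2 ≤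
        (periodicEnergy v Φ).toReal - (periodicGroundStateEnergy v N L).toReal + D) →
    (∀ q : Fin 3 → ℤ,
      periodicGroundStateEnergy v N L + ENNReal.ofReal Δ ≤
          momentumSectorEnergy v N L
            ((2 * Real.pi / L) • (WithLp.toLp 2 fun t => (q t : ℝ) : EuclideanSpace ℝ (Fin 3))) ∨
      periodicGroundStateEnergy v N L + ENNReal.ofReal Δ ≤
          momentumSectorEnergy v N L
            ((2 * Real.pi / L) • (WithLp.toLp 2 fun t => ((q + k) t : ℝ) : EuclideanSpace ℝ (Fin 3)))) →
    ∀ Ψ : PeriodicTrialState N L, periodicEnergy v Ψ ≠ ⊤ →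
      cosMean L k Ψ ^ 2 ≤
        4 * ((1 + D / Δ) / lam) *
          ((periodicEnergy v Ψ).toReal - (periodicGroundStateEnergy v N L).toReal)

/-- **Stub C — the window reduction** `A → B → StaticResponseBoundPhonon` (a theorem of this file modulo
C1, C2α, C2β, C3: `stub_windowReduction` below). -/
def WindowReduction : Prop :=
  SoftenedModeHyperuniformity → SectorFloor → StaticResponseBoundPhonon

/-! ### The REGISTERED stubs (v2), statements written out in tree vocabulary -/

/-- **A (lead, XL)** `stub_softenedModeHyperuniformity` — verbatim `SoftenedModeHyperuniformity` with
`IsSoftenedNearMin`, `softenedEnergy`, `vertex`, `densityWaveSqMean` unfolded. -/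
theorem stub_softenedModeHyperuniformity :
    ∀ v : ℝ → ℝ≥0∞, IsRepulsiveFiniteRange v → ∀ M₀ : ℝ, 0 < M₀ →
      ∃ ρ₀ : ℝ, 0 < ρ₀ ∧ ∃ θ : ℝ, 0 < θ ∧ ∃ C_H : ℝ, 0 ≤ C_H ∧
        ∀ ρ : ℝ, 0 < ρ → ρ < ρ₀ → ∀ N : ℕ, 0 < N → ∀ k : Fin 3 → ℤ, k ≠ 0 →
          psq (sideLength ρ N) k ≤ M₀ ^ 2 * (ρ * (scatteringLength v).toReal) →
          ∃ δ : ℝ, 0 < δ ∧ ∀ Φ : PeriodicTrialState N (sideLength ρ N),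
            (periodicEnergy v Φ ≠ ⊤ ∧
              ∀ Φ' : PeriodicTrialState N (sideLength ρ N), periodicEnergy v Φ' ≠ ⊤ →
                (periodicEnergy v Φ).toReal -
                    θ * (8 * Real.pi * (scatteringLength v).toReal +
                        psq (sideLength ρ N) k / (2 * ρ)) / sideLength ρ N ^ 3 *
                      ((∫ X in cellN N (sideLength ρ N),
                          ‖densityWave N (sideLength ρ N) k X‖ ^ 2 * ‖Φ.ψ X‖ ^ 2) - N) ≤
                  (periodicEnergy v Φ').toReal -
                    θ * (8 * Real.pi * (scatteringLength v).toReal +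
                        psq (sideLength ρ N) k / (2 * ρ)) / sideLength ρ N ^ 3 *
                      ((∫ X in cellN N (sideLength ρ N),
                          ‖densityWave N (sideLength ρ N) k X‖ ^ 2 * ‖Φ'.ψ X‖ ^ 2) - N) + δ) →
            (∫ X in cellN N (sideLength ρ N),
                ‖densityWave N (sideLength ρ N) k X‖ ^ 2 * ‖Φ.ψ X‖ ^ 2) ≤
              C_H * N * Real.sqrt (psq (sideLength ρ N) k) /
                Real.sqrt (ρ * (scatteringLength v).toReal) := by
  sorry

/-- **B (XL)** `stub_sectorFloor` — verbatim `SectorFloor`. -/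
theorem stub_sectorFloor :
    ∀ v : ℝ → ℝ≥0∞, IsRepulsiveFiniteRange v → ∀ M₀ : ℝ, 0 < M₀ →
      ∃ θL : ℝ, 0 < θL ∧ ∃ ρ₀ : ℝ, 0 < ρ₀ ∧ ∀ ρ : ℝ, 0 < ρ → ρ < ρ₀ → ∀ N : ℕ, 0 < N →
        ∀ m : Fin 3 → ℤ, m ≠ 0 →
          periodicGroundStateEnergy v N (sideLength ρ N)
              + ENNReal.ofReal (θL * Real.sqrt (ρ * (scatteringLength v).toReal)
                  * min (Real.sqrt (psq (sideLength ρ N) m))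
                        (M₀ * Real.sqrt (ρ * (scatteringLength v).toReal)))
            ≤ momentumSectorEnergy v N (sideLength ρ N)
                ((2 * Real.pi / sideLength ρ N) •
                  (WithLp.toLp 2 fun t => (m t : ℝ) : EuclideanSpace ℝ (Fin 3))) := by
  sorry

/-- **C1 (S)** `stub_ecsf_of_hyperuniformity` — the variational principle: A ⇒ ECSF.  Proof: fix a
finite-energy `Φ'`; the softened functional is bounded below on finite-energy states (`E ≥ 0`,
`⟨|ρ̂_p|²⟩ ≤ N²`), so for `0 < δ' ≤ δ` there is a `δ'`-near-minimiser `Φ`, to which A applies; comparing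
`F(Φ) ≤ F(Φ') + δ'`, `E_Φ ≥ E₀` and letting `δ' → 0` gives the claim. -/
theorem stub_ecsf_of_hyperuniformity :
    (∀ v : ℝ → ℝ≥0∞, IsRepulsiveFiniteRange v → ∀ M₀ : ℝ, 0 < M₀ →
      ∃ ρ₀ : ℝ, 0 < ρ₀ ∧ ∃ θ : ℝ, 0 < θ ∧ ∃ C_H : ℝ, 0 ≤ C_H ∧
        ∀ ρ : ℝ, 0 < ρ → ρ < ρ₀ → ∀ N : ℕ, 0 < N → ∀ k : Fin 3 → ℤ, k ≠ 0 →
          psq (sideLength ρ N) k ≤ M₀ ^ 2 * (ρ * (scatteringLength v).toReal) →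
          ∃ δ : ℝ, 0 < δ ∧ ∀ Φ : PeriodicTrialState N (sideLength ρ N),
            (periodicEnergy v Φ ≠ ⊤ ∧
              ∀ Φ' : PeriodicTrialState N (sideLength ρ N), periodicEnergy v Φ' ≠ ⊤ →
                (periodicEnergy v Φ).toReal -
                    θ * (8 * Real.pi * (scatteringLength v).toReal +
                        psq (sideLength ρ N) k / (2 * ρ)) / sideLength ρ N ^ 3 *
                      ((∫ X in cellN N (sideLength ρ N),
                          ‖densityWave N (sideLength ρ N) k X‖ ^ 2 * ‖Φ.ψ X‖ ^ 2) - N) ≤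
                  (periodicEnergy v Φ').toReal -
                    θ * (8 * Real.pi * (scatteringLength v).toReal +
                        psq (sideLength ρ N) k / (2 * ρ)) / sideLength ρ N ^ 3 *
                      ((∫ X in cellN N (sideLength ρ N),
                          ‖densityWave N (sideLength ρ N) k X‖ ^ 2 * ‖Φ'.ψ X‖ ^ 2) - N) + δ) →
            (∫ X in cellN N (sideLength ρ N),
                ‖densityWave N (sideLength ρ N) k X‖ ^ 2 * ‖Φ.ψ X‖ ^ 2) ≤
              C_H * N * Real.sqrt (psq (sideLength ρ N) k) /
                Real.sqrt (ρ * (scatteringLength v).toReal)) →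
    ∀ v : ℝ → ℝ≥0∞, IsRepulsiveFiniteRange v → ∀ M₀ : ℝ, 0 < M₀ →
      ∃ ρ₀ : ℝ, 0 < ρ₀ ∧ ∃ θ : ℝ, 0 < θ ∧ ∃ C_H : ℝ, 0 ≤ C_H ∧
        ∀ ρ : ℝ, 0 < ρ → ρ < ρ₀ → ∀ N : ℕ, 0 < N → ∀ k : Fin 3 → ℤ, k ≠ 0 →
          psq (sideLength ρ N) k ≤ M₀ ^ 2 * (ρ * (scatteringLength v).toReal) →
          ∀ Φ : PeriodicTrialState N (sideLength ρ N), periodicEnergy v Φ ≠ ⊤ →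
            θ * (8 * Real.pi * (scatteringLength v).toReal + psq (sideLength ρ N) k / (2 * ρ)) /
                sideLength ρ N ^ 3 *
                (∫ X in cellN N (sideLength ρ N),
                  ‖densityWave N (sideLength ρ N) k X‖ ^ 2 * ‖Φ.ψ X‖ ^ 2) ≤
              (periodicEnergy v Φ).toReal - (periodicGroundStateEnergy v N (sideLength ρ N)).toReal +
                θ * (8 * Real.pi * (scatteringLength v).toReal + psq (sideLength ρ N) k / (2 * ρ)) /
                  sideLength ρ N ^ 3 *
                  (C_H * N * Real.sqrt (psq (sideLength ρ N) k) /
                    Real.sqrt (ρ * (scatteringLength v).toReal)) := by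
  sorry

/-- **C2α (L)** `stub_sectorDecomposition` — verbatim `SectorDecomposition`: Bloch / centre-of-mass Fourier
components of a periodic `C¹` state (differentiate under the integral; Parseval on the 3-torus fibrewise in
the centre-of-mass translation `s ↦ Ψ(X + s𝟙)`, Tonelli, translation invariance of cell integrals of periodic
functions — tree: `TorusFourierCalculus`, `PeriodicConfigFourier`, `PeriodicBoseGasFourier`). -/
theorem stub_sectorDecomposition :
    ∀ (v : ℝ → ℝ≥0∞) (N : ℕ) (L : ℝ), 0 < L → ∀ (k : Fin 3 → ℤ) (Ψ : PeriodicTrialState N L),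
      ∃ Φc : (Fin 3 → ℤ) → Config N → ℂ,
        (∀ q, ContDiff ℝ 1 (Φc q)) ∧
        (∀ q (X : Config N) (i : Fin N) (a : Fin 3),
          Φc q (X + Pi.single i (EuclideanSpace.single a L)) = Φc q X) ∧
        (∀ q (σ : Equiv.Perm (Fin N)) (X : Config N), Φc q (X ∘ σ) = Φc q X) ∧
        (∀ q, HasTotalMomentum
          ((2 * Real.pi / L) • (WithLp.toLp 2 fun t => (q t : ℝ) : EuclideanSpace ℝ (Fin 3))) (Φc q)) ∧
        (∑' q, ∫⁻ X in cellN N L, (‖Φc q X‖₊ : ℝ≥0∞) ^ 2) = 1 ∧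
        (∑' q, ∫⁻ X in cellN N L,
            (kineticDensity (Φc q) X + periodicInteraction v L X * (‖Φc q X‖₊ : ℝ≥0∞) ^ 2)) =
          periodicEnergy v Ψ ∧
        HasSum (fun q : Fin 3 → ℤ =>
            ∫ X in cellN N L, conj (Φc (q + k) X) * (densityWave N L k X * Φc q X))
          (∫ X in cellN N L, densityWave N L k X * (((‖Ψ.ψ X‖ ^ 2 : ℝ)) : ℂ)) := by
  sorry

/-- **C2β (M)** `stub_sectorCauchySchwarz` — `SectorDecomposition → SectorCauchySchwarz`: with
`w_q = ‖Φc q‖²`, `X_q = ⟨Φc q,HΦc q⟩ − E₀w_q ≥ 0` (`∑w_q = 1`, `∑X_q = E_Ψ − E₀`), normalise the non-zero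
components (`PeriodicTrialState.ofFun`, homogeneity of the form), apply ECSF and the floor on the stiffer
member `s` of each pair: `|⟨Φc(q+k), ρ̂_kΦc q⟩|² ≤ w_o (1 + D/Δ)X_s/λ`; Cauchy–Schwarz over `q` (each sector is
`o`/`s` for at most two pairs) and `Re ∑_q ⟨Φc(q+k), ρ̂_kΦc q⟩ = ⟨∑cos⟩_Ψ`. -/
theorem stub_sectorCauchySchwarz :
    (∀ (v : ℝ → ℝ≥0∞) (N : ℕ) (L : ℝ), 0 < L → ∀ (k : Fin 3 → ℤ) (Ψ : PeriodicTrialState N L),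
      ∃ Φc : (Fin 3 → ℤ) → Config N → ℂ,
        (∀ q, ContDiff ℝ 1 (Φc q)) ∧
        (∀ q (X : Config N) (i : Fin N) (a : Fin 3),
          Φc q (X + Pi.single i (EuclideanSpace.single a L)) = Φc q X) ∧
        (∀ q (σ : Equiv.Perm (Fin N)) (X : Config N), Φc q (X ∘ σ) = Φc q X) ∧
        (∀ q, HasTotalMomentum
          ((2 * Real.pi / L) • (WithLp.toLp 2 fun t => (q t : ℝ) : EuclideanSpace ℝ (Fin 3))) (Φc q)) ∧
        (∑' q, ∫⁻ X in cellN N L, (‖Φc q X‖₊ : ℝ≥0∞) ^ 2) = 1 ∧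
        (∑' q, ∫⁻ X in cellN N L,
            (kineticDensity (Φc q) X + periodicInteraction v L X * (‖Φc q X‖₊ : ℝ≥0∞) ^ 2)) =
          periodicEnergy v Ψ ∧
        HasSum (fun q : Fin 3 → ℤ =>
            ∫ X in cellN N L, conj (Φc (q + k) X) * (densityWave N L k X * Φc q X))
          (∫ X in cellN N L, densityWave N L k X * (((‖Ψ.ψ X‖ ^ 2 : ℝ)) : ℂ))) →
    ∀ (v : ℝ → ℝ≥0∞) (N : ℕ) (L : ℝ), 0 < L → ∀ (k : Fin 3 → ℤ), k ≠ 0 →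
      ∀ (lam D Δ : ℝ), 0 < lam → 0 ≤ D → 0 < Δ →
      (∀ Φ : PeriodicTrialState N L, periodicEnergy v Φ ≠ ⊤ →
        lam * ∫ X in cellN N L, ‖densityWave N L k X‖ ^ 2 * ‖Φ.ψ X‖ ^ 2 ≤
          (periodicEnergy v Φ).toReal - (periodicGroundStateEnergy v N L).toReal + D) →
      (∀ q : Fin 3 → ℤ,
        periodicGroundStateEnergy v N L + ENNReal.ofReal Δ ≤
            momentumSectorEnergy v N L
              ((2 * Real.pi / L) • (WithLp.toLp 2 fun t => (q t : ℝ) : EuclideanSpace ℝ (Fin 3))) ∨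
        periodicGroundStateEnergy v N L + ENNReal.ofReal Δ ≤
            momentumSectorEnergy v N L
              ((2 * Real.pi / L) •
                (WithLp.toLp 2 fun t => ((q + k) t : ℝ) : EuclideanSpace ℝ (Fin 3)))) →
      ∀ Ψ : PeriodicTrialState N L, periodicEnergy v Ψ ≠ ⊤ →
        cosMean L k Ψ ^ 2 ≤
          4 * ((1 + D / Δ) / lam) *
            ((periodicEnergy v Ψ).toReal - (periodicGroundStateEnergy v N L).toReal) := by
  sorry

/-- **C3 (M)** `stub_windowAssembly` — `EnergyControlledStructureFactor → SectorFloor → SectorCauchySchwarz →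
StaticResponseBoundPhonon`: fix `v, M₀`; `(ρ₀, θ, C_H)` from ECSF at `M₀`, `(θ_L, ρ₀′)` from the floor at
`M₀/2`; `C := 2(1+K₀)/θ`, `K₀ := 2θ(8π + M₀²/2)C_H/θ_L`.  For `N ≥ 1`, `k ≠ 0` in the window
(`a > 0` there, `L³ = N/ρ`, `λ = θ(8πρa + |p|²/2)/N ≥ θ·max(ρa,|p|²)/(2N)`, `D/Δ ≤ K₀` with
`Δ = θ_L√(ρa)|p|/2`, the floor disjunction from `max(|q|,|q+p|) ≥ |p|/2`), SectorCauchySchwarz and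
`Negative.forall_ineq_iff_discriminant` give `Ineq v C ρ N k t Ψ`. -/
theorem stub_windowAssembly :
    (∀ v : ℝ → ℝ≥0∞, IsRepulsiveFiniteRange v → ∀ M₀ : ℝ, 0 < M₀ →
      ∃ ρ₀ : ℝ, 0 < ρ₀ ∧ ∃ θ : ℝ, 0 < θ ∧ ∃ C_H : ℝ, 0 ≤ C_H ∧
        ∀ ρ : ℝ, 0 < ρ → ρ < ρ₀ → ∀ N : ℕ, 0 < N → ∀ k : Fin 3 → ℤ, k ≠ 0 →
          psq (sideLength ρ N) k ≤ M₀ ^ 2 * (ρ * (scatteringLength v).toReal) →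
          ∀ Φ : PeriodicTrialState N (sideLength ρ N), periodicEnergy v Φ ≠ ⊤ →
            θ * (8 * Real.pi * (scatteringLength v).toReal + psq (sideLength ρ N) k / (2 * ρ)) /
                sideLength ρ N ^ 3 *
                (∫ X in cellN N (sideLength ρ N),
                  ‖densityWave N (sideLength ρ N) k X‖ ^ 2 * ‖Φ.ψ X‖ ^ 2) ≤
              (periodicEnergy v Φ).toReal - (periodicGroundStateEnergy v N (sideLength ρ N)).toReal +
                θ * (8 * Real.pi * (scatteringLength v).toReal + psq (sideLength ρ N) k / (2 * ρ)) /
                  sideLength ρ N ^ 3 *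
                  (C_H * N * Real.sqrt (psq (sideLength ρ N) k) /
                    Real.sqrt (ρ * (scatteringLength v).toReal))) →
    (∀ v : ℝ → ℝ≥0∞, IsRepulsiveFiniteRange v → ∀ M₀ : ℝ, 0 < M₀ →
      ∃ θL : ℝ, 0 < θL ∧ ∃ ρ₀ : ℝ, 0 < ρ₀ ∧ ∀ ρ : ℝ, 0 < ρ → ρ < ρ₀ → ∀ N : ℕ, 0 < N →
        ∀ m : Fin 3 → ℤ, m ≠ 0 →
          periodicGroundStateEnergy v N (sideLength ρ N)
              + ENNReal.ofReal (θL * Real.sqrt (ρ * (scatteringLength v).toReal)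
                  * min (Real.sqrt (psq (sideLength ρ N) m))
                        (M₀ * Real.sqrt (ρ * (scatteringLength v).toReal)))
            ≤ momentumSectorEnergy v N (sideLength ρ N)
                ((2 * Real.pi / sideLength ρ N) •
                  (WithLp.toLp 2 fun t => (m t : ℝ) : EuclideanSpace ℝ (Fin 3)))) →
    (∀ (v : ℝ → ℝ≥0∞) (N : ℕ) (L : ℝ), 0 < L → ∀ (k : Fin 3 → ℤ), k ≠ 0 →
      ∀ (lam D Δ : ℝ), 0 < lam → 0 ≤ D → 0 < Δ →
      (∀ Φ : PeriodicTrialState N L, periodicEnergy v Φ ≠ ⊤ →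
        lam * ∫ X in cellN N L, ‖densityWave N L k X‖ ^ 2 * ‖Φ.ψ X‖ ^ 2 ≤
          (periodicEnergy v Φ).toReal - (periodicGroundStateEnergy v N L).toReal + D) →
      (∀ q : Fin 3 → ℤ,
        periodicGroundStateEnergy v N L + ENNReal.ofReal Δ ≤
            momentumSectorEnergy v N L
              ((2 * Real.pi / L) • (WithLp.toLp 2 fun t => (q t : ℝ) : EuclideanSpace ℝ (Fin 3))) ∨
        periodicGroundStateEnergy v N L + ENNReal.ofReal Δ ≤
            momentumSectorEnergy v N L
              ((2 * Real.pi / L) •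
                (WithLp.toLp 2 fun t => ((q + k) t : ℝ) : EuclideanSpace ℝ (Fin 3)))) →
      ∀ Ψ : PeriodicTrialState N L, periodicEnergy v Ψ ≠ ⊤ →
        cosMean L k Ψ ^ 2 ≤
          4 * ((1 + D / Δ) / lam) *
            ((periodicEnergy v Ψ).toReal - (periodicGroundStateEnergy v N L).toReal)) →
    ∀ v : ℝ → ℝ≥0∞, IsRepulsiveFiniteRange v → ∀ M₀ : ℝ, 0 < M₀ →
      ∃ ρ₀ : ℝ, 0 < ρ₀ ∧ ∃ C : ℝ, 0 < C ∧
        ∀ ρ : ℝ, 0 < ρ → ρ < ρ₀ → ∀ N : ℕ, 0 < N → ∀ k : Fin 3 → ℤ, k ≠ 0 →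
          psq (sideLength ρ N) k ≤ M₀ ^ 2 * (ρ * (scatteringLength v).toReal) →
          ∀ t : ℝ, ∀ Ψ : PeriodicTrialState N (sideLength ρ N), periodicEnergy v Ψ ≠ ⊤ →
            Ineq v C ρ N k t Ψ := by
  sorry

/-- **D (interface)** `stub_kineticBranch` — verbatim `StaticResponseBoundKinetic` = the sibling skeleton's
`KineticBranch` (`Lines/uv-thomson-force-wave.lean`, `kineticBranch_of`). -/
theorem stub_kineticBranch :
    ∀ v : ℝ → ℝ≥0∞, IsRepulsiveFiniteRange v →
      ∃ M₀ : ℝ, 0 < M₀ ∧ ∃ ρ₀ : ℝ, 0 < ρ₀ ∧ ∃ C : ℝ, 0 < C ∧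
        ∀ ρ : ℝ, 0 < ρ → ρ < ρ₀ → ∀ N : ℕ, 0 < N → ∀ k : Fin 3 → ℤ, k ≠ 0 →
          M₀ ^ 2 * (ρ * (scatteringLength v).toReal) < psq (sideLength ρ N) k →
          ∀ t : ℝ, ∀ Ψ : PeriodicTrialState N (sideLength ρ N), periodicEnergy v Ψ ≠ ⊤ →
            Ineq v C ρ N k t Ψ := by
  sorry

/-! ### The registered texts ARE the readable statements (definitional unfolding) -/

/-- A by name. -/
theorem softenedModeHyperuniformity_holds : SoftenedModeHyperuniformity :=
  stub_softenedModeHyperuniformity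

/-- B by name. -/
theorem sectorFloor_holds : SectorFloor := stub_sectorFloor

/-- C1 by name. -/
theorem ecsf_of_hyperuniformity : SoftenedModeHyperuniformity → EnergyControlledStructureFactor :=
  stub_ecsf_of_hyperuniformity

/-- C2α by name. -/
theorem sectorDecomposition_holds : SectorDecomposition := stub_sectorDecomposition

/-- C2β by name. -/
theorem sectorCauchySchwarz_of_decomposition : SectorDecomposition → SectorCauchySchwarz :=
  stub_sectorCauchySchwarz

/-- C3 by name. -/
theorem windowAssembly :
    EnergyControlledStructureFactor → SectorFloor → SectorCauchySchwarz → StaticResponseBoundPhonon :=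
  stub_windowAssembly

/-- D by name. -/
theorem kineticBranch_holds : StaticResponseBoundKinetic := stub_kineticBranch

/-- **Stub C of the planner's skeleton is now GLUE**: `WindowReduction` from C1, C2α, C2β, C3. -/
theorem stub_windowReduction : WindowReduction := fun hA hB =>
  windowAssembly (ecsf_of_hyperuniformity hA) hB
    (sectorCauchySchwarz_of_decomposition sectorDecomposition_holds)

/-! ### The kernel-checked composition -/

/-- Monotonicity of the inner inequality in the constant (a larger `C` only weakens it). -/
theorem ineq_mono_C {v : ℝ → ℝ≥0∞} {C C' ρ : ℝ} {N : ℕ} {k : Fin 3 → ℤ} {t : ℝ}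
    {Ψ : PeriodicTrialState N (sideLength ρ N)} (h : Ineq v C ρ N k t Ψ) (hCC' : C ≤ C') :
    Ineq v C' ρ N k t Ψ := by
  unfold Ineq at h ⊢
  have hmax : 0 ≤ max (ρ * (scatteringLength v).toReal) (psq (sideLength ρ N) k) :=
    le_max_of_le_right (by unfold psq; positivity)
  have hle : C * t ^ 2 * N / max (ρ * (scatteringLength v).toReal) (psq (sideLength ρ N) k) ≤
      C' * t ^ 2 * N / max (ρ * (scatteringLength v).toReal) (psq (sideLength ρ N) k) := by
    apply div_le_div_of_nonneg_right _ hmax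
    have : (0 : ℝ) ≤ t ^ 2 * N := by positivity
    nlinarith
  linarith

/-- **The composition**: A, B, the window reduction and the kinetic branch imply the crux BY NAME.
`N = 0` is `Negative.ineq_N_zero`; for `N ≥ 1` split on `|p|² ≤ M₀²ρa` with `M₀` taken from the kinetic
stub, `ρ₀ := min`, `C := max`. -/
theorem StaticResponseBound_of :
    SoftenedModeHyperuniformity → SectorFloor → WindowReduction → StaticResponseBoundKinetic →
      _root_.Summit.AtomisticToContinuum.BoseEinsteinCondensation.Theses.BECInsertionCorrector.StaticResponseBound := by
  intro hA hB hW hK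
  rw [staticResponseBound_iff]
  intro v hv
  obtain ⟨M₀, hM₀, ρ₁, hρ₁, C₁, hC₁, hKin⟩ := hK v hv
  obtain ⟨ρ₂, hρ₂, C₂, hC₂, hPh⟩ := hW hA hB v hv M₀ hM₀
  refine ⟨min ρ₁ ρ₂, lt_min hρ₁ hρ₂, max C₁ C₂, lt_of_lt_of_le hC₁ (le_max_left _ _), ?_⟩
  intro ρ hρ hρlt N k hk t Ψ hΨ
  rcases Nat.eq_zero_or_pos N with hN | hN
  · subst hN
    exact ineq_N_zero v _ ρ k t Ψ hΨ
  · rcases le_or_gt (psq (sideLength ρ N) k) (M₀ ^ 2 * (ρ * (scatteringLength v).toReal)) with hle | hlt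
    · exact ineq_mono_C (hPh ρ hρ (lt_of_lt_of_le hρlt (min_le_right _ _)) N hN k hk hle t Ψ hΨ)
        (le_max_right _ _)
    · exact ineq_mono_C (hKin ρ hρ (lt_of_lt_of_le hρlt (min_le_left _ _)) N hN k hk hlt t Ψ hΨ)
        (le_max_left _ _)

/-- **`StaticResponseBound` from the line `stable-fraction-square-completion`**: the crux BY NAME — the only
`sorry`s in its cone are the registered stubs A, B, C1, C2α, C2β, C3, D. -/
theorem StaticResponseBound_proof :
    _root_.Summit.AtomisticToContinuum.BoseEinsteinCondensation.Theses.BECInsertionCorrector.StaticResponseBound :=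
  StaticResponseBound_of softenedModeHyperuniformity_holds sectorFloor_holds stub_windowReduction
    kineticBranch_holds

end

end Summit.AtomisticToContinuum.BoseEinsteinCondensation.Cruxes.StaticResponseBound.StableFractionSquareCompletion
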